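import Summits.CriticalPhenomena.PercolationContinuityZ3.Theorems.PercNearOneGluingNoHeavyLowerTailKnQuestion8CoefficientwiseNCStarCycleClusters
import Summits.CriticalPhenomena.PercolationContinuityZ3.Theorems.PercNearOneGluingNoHeavyLowerTailKnQuestion8CoefficientwiseRootEdgeDomination
import HarnessLib

/-!
# Book graphs: the clusters of the root and the residual involution ψ (part 1 of (REM) on book graphs) — prim-lf-2 gen 68

Support file (`--supports stmt-CriticalPhenomena-4575`, closed), prover `prim-lf-2` (gen 68).  No definitions, no named facts, no sorries; standard axioms.
Memo `prim-lf-2/CW-SUBROWS-gen68.md` §8, §11 (Target 1).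

The BOOK GRAPH `B_k`: root `x`, pole `h`, leaves `ℓ_i` (`i : Fin k`), edges `ea i = {x, ℓ_i}`, `eb i = {ℓ_i, h}` and the spine `e = {x, h}` (= `k` triangles sharing `e`;
= the θ-graph `K_{2,k}` plus the pole edge).  CONJECTURE (REM) (prim-lf-2 gen 66): `REM_E(e; x, W)[g] := Σ_{s ⊆ E : e ∈ s, ∀ w∈W ¬(w ∈ C_x s ∧ w ∈ C_x(E∖s))} (g(C_x s) − g(C_x(E∖s))) ≥ 0`.
* `Coefficientwise.book_mem_openCluster_iff_leaf` / `_pole` / `book_openCluster_subset` — the clusters of the root on a book graph: `ℓ_i ∈ C_x(s) ↔ ea i ∈ s ∨ (eb i ∈ s ∧ h ∈ C_x s)`,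
  `h ∈ C_x(s) ↔ e ∈ s ∨ ∃ j, ea j ∈ s ∧ eb j ∈ s`, and `C_x(s) ⊆ {x, h} ∪ {ℓ_i}`.
* `Coefficientwise.bookKeep` / `bookNewA` / `bookNewB` / `bookPsi` — the residual involution `ψ` of memo §8/§11 (complement both edges of every mixed leaf except the D-leaves
  `(ea i ∈ s, eb i ∉ s, ℓ_i ∈ W)`; the spine stays red), with `book_edges_distinct`, `book_mem_psi`, `book_psi_subset`.
Part 2 (`…CoefficientwiseRemBook.lean`) proves `rem_nonneg_book`: (REM) for every target set on every book graph.
[cite: KozmaNitzan2024, Questions 8–9 (§5.5 p. 36) (context: the Question-8 pocket covariance programme)]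
-/

namespace Summit.CriticalPhenomena.PercolationContinuityZ3.Theorems

open Finset Literature.Probability.Percolation

namespace Coefficientwise

variable {ι V : Type*}

section Book

variable (ends : ι → Sym2 V) {k : ℕ} (x h : V) (lf : Fin k → V) (ea eb : Fin k → ι) (e : ι) (E : Finset ι)
variable (hxh : x ≠ h) (hlx : ∀ i, lf i ≠ x) (hlh : ∀ i, lf i ≠ h) (hlf : Function.Injective lf)
variable (hends_e : ends e = s(x, h)) (hends_a : ∀ i, ends (ea i) = s(x, lf i)) (hends_b : ∀ i, ends (eb i) = s(lf i, h))
variable (hE : ∀ j, j ∈ E ↔ j = e ∨ (∃ i, j = ea i) ∨ (∃ i, j = eb i))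

/-! ### The clusters of the root on a book graph -/

include hxh hlx hlh hlf hends_e hends_a hends_b hE in
/-- On a book graph, the red cluster of the root for `s ⊆ E` is contained in the explicit set `{x} ∪ {h | e ∈ s ∨ ∃ j, ea j, eb j ∈ s} ∪ {ℓ_i | ea i ∈ s ∨ (eb i ∈ s ∧ (e ∈ s ∨ ∃ j …))}`.
[cite: KozmaNitzan2024, §5.5 (context only; folklore)] -/
theorem book_openCluster_subset_explicit (s : Finset ι) (hs : s ⊆ E) :
    openCluster (ends '' (↑s : Set ι)) x ⊆
      {v | v = x ∨ (v = h ∧ (e ∈ s ∨ ∃ j, ea j ∈ s ∧ eb j ∈ s)) ∨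
        ∃ i, v = lf i ∧ (ea i ∈ s ∨ (eb i ∈ s ∧ (e ∈ s ∨ ∃ j, ea j ∈ s ∧ eb j ∈ s)))} := by
  refine openCluster_subset_of_closed ends s x (Or.inl rfl) ?_
  intro j hj a b hab ha
  have hjE := (hE j).mp (hs hj)
  -- `Sym2` bookkeeping: `ends j = s(a,b)` together with the known value of `ends j`
  rcases hjE with hje | ⟨i, hji⟩ | ⟨i, hji⟩
  · -- the spine `e = {x,h}`
    rw [hje] at hj hab
    have hh : e ∈ s ∨ ∃ j, ea j ∈ s ∧ eb j ∈ s := Or.inl hj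
    rw [hends_e] at hab
    rcases Sym2.eq_iff.mp hab with ⟨hxa, hhb⟩ | ⟨hxb, hha⟩
    · exact Or.inr (Or.inl ⟨hhb.symm, hh⟩)
    · exact Or.inl hxb.symm
  · -- a leaf edge at the root `ea i = {x, ℓ_i}`
    rw [hji] at hj hab
    rw [hends_a i] at hab
    rcases Sym2.eq_iff.mp hab with ⟨hxa, hlb⟩ | ⟨hxb, hla⟩
    · exact Or.inr (Or.inr ⟨i, hlb.symm, Or.inl hj⟩)
    · exact Or.inl hxb.symm
  · -- a leaf edge at the pole `eb i = {ℓ_i, h}`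
    rw [hji] at hj hab
    rw [hends_b i] at hab
    rcases Sym2.eq_iff.mp hab with ⟨hla, hhb⟩ | ⟨hlb, hha⟩
    · -- `a = ℓ_i`, `b = h`: `ℓ_i ∈ S` gives `ea i ∈ s` or `(eb i ∈ s ∧ through)`
      rcases ha with hax | ⟨hah, hh⟩ | ⟨i', hai', hi'⟩
      · exact absurd (hla ▸ hax) (hlx i)
      · exact absurd (hla ▸ hah) (hlh i)
      · have hii : i' = i := hlf (hai' ▸ hla ▸ rfl)
        subst hii
        rcases hi' with hai | ⟨_, hh⟩
        · exact Or.inr (Or.inl ⟨hhb.symm, Or.inr ⟨i', hai, hj⟩⟩)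
        · exact Or.inr (Or.inl ⟨hhb.symm, hh⟩)
    · -- `a = h`, `b = ℓ_i`: `h ∈ S` gives through/e, hence `ℓ_i` via `eb i`
      rcases ha with hax | ⟨_, hh⟩ | ⟨i', hai', _⟩
      · exact absurd (hha ▸ hax) hxh.symm
      · exact Or.inr (Or.inr ⟨i, hlb.symm, Or.inr ⟨hj, hh⟩⟩)
      · exact absurd (hai' ▸ hha ▸ rfl : lf i' = h) (hlh i')

include hxh hlx hlh hlf hends_e hends_a hends_b hE in
/-- **Pole membership.**  `h ∈ C_x(s) ↔ e ∈ s ∨ ∃ j, ea j ∈ s ∧ eb j ∈ s`. [cite: KozmaNitzan2024, §5.5 (context only; folklore)] -/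
theorem book_mem_openCluster_iff_pole (s : Finset ι) (hs : s ⊆ E) :
    h ∈ openCluster (ends '' (↑s : Set ι)) x ↔ (e ∈ s ∨ ∃ j, ea j ∈ s ∧ eb j ∈ s) := by
  constructor
  · intro hmem
    rcases book_openCluster_subset_explicit ends x h lf ea eb e E hxh hlx hlh hlf hends_e hends_a hends_b hE s hs hmem with hhx | ⟨_, hh⟩ | ⟨i, hhi, _⟩
    · exact absurd hhx hxh.symm
    · exact hh
    · exact absurd hhi.symm (hlh i)
  · rintro (hes | ⟨j, hja, hjb⟩)
    · exact mem_openCluster_of_edge ends hes hends_e (mem_openCluster_self _ x)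
    · exact mem_openCluster_of_edge ends hjb (hends_b j) (mem_openCluster_of_edge ends hja (hends_a j) (mem_openCluster_self _ x))

include hxh hlx hlh hlf hends_e hends_a hends_b hE in
/-- **Leaf membership.**  `ℓ_i ∈ C_x(s) ↔ ea i ∈ s ∨ (eb i ∈ s ∧ h ∈ C_x(s))`. [cite: KozmaNitzan2024, §5.5 (context only; folklore)] -/
theorem book_mem_openCluster_iff_leaf (s : Finset ι) (hs : s ⊆ E) (i : Fin k) :
    lf i ∈ openCluster (ends '' (↑s : Set ι)) x ↔ (ea i ∈ s ∨ (eb i ∈ s ∧ (e ∈ s ∨ ∃ j, ea j ∈ s ∧ eb j ∈ s))) := by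
  constructor
  · intro hmem
    rcases book_openCluster_subset_explicit ends x h lf ea eb e E hxh hlx hlh hlf hends_e hends_a hends_b hE s hs hmem with hlx' | ⟨hlh', _⟩ | ⟨i', hii', hi'⟩
    · exact absurd hlx' (hlx i)
    · exact absurd hlh' (hlh i)
    · rw [hlf hii'] ; exact hi'
  · rintro (hai | ⟨hbi, hh⟩)
    · exact mem_openCluster_of_edge ends hai (hends_a i) (mem_openCluster_self _ x)
    · have hhm : h ∈ openCluster (ends '' (↑s : Set ι)) x :=
        (book_mem_openCluster_iff_pole ends x h lf ea eb e E hxh hlx hlh hlf hends_e hends_a hends_b hE s hs).mpr hh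
      exact mem_openCluster_of_edge ends hbi (by rw [hends_b i, Sym2.eq_swap]) hhm

include hxh hlx hlh hlf hends_e hends_a hends_b hE in
/-- Every vertex of `C_x(s)` on a book graph is `x`, `h` or a leaf. [cite: KozmaNitzan2024, §5.5 (context only; folklore)] -/
theorem book_openCluster_cases (s : Finset ι) (hs : s ⊆ E) {v : V} (hv : v ∈ openCluster (ends '' (↑s : Set ι)) x) :
    v = x ∨ v = h ∨ ∃ i, v = lf i := by
  rcases book_openCluster_subset_explicit ends x h lf ea eb e E hxh hlx hlh hlf hends_e hends_a hends_b hE s hs hv with h1 | ⟨h2, _⟩ | ⟨i, h3, _⟩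
  · exact Or.inl h1
  · exact Or.inr (Or.inl h2)
  · exact Or.inr (Or.inr ⟨i, h3⟩)

/-! ### The residual matching `ψ` (memo §8/§11): complement both edges of every mixed leaf, except the D-leaves `(ea i ∈ s, eb i ∉ s, ℓ_i ∈ W)` -/

variable [DecidableEq ι] (W : Set V)

/-- A leaf keeps its colours under `ψ` iff it is monochromatic (through) or a D-leaf `(ea i red, eb i blue, ℓ_i ∈ W)`. -/
def bookKeep (s : Finset ι) (i : Fin k) : Prop :=
  (ea i ∈ s ↔ eb i ∈ s) ∨ (ea i ∈ s ∧ eb i ∉ s ∧ lf i ∈ W)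

/-- New colour of `ea i` under `ψ` (red iff …). -/
def bookNewA (s : Finset ι) (i : Fin k) : Prop :=
  (bookKeep lf ea eb W s i ∧ ea i ∈ s) ∨ (¬ bookKeep lf ea eb W s i ∧ eb i ∈ s)

/-- New colour of `eb i` under `ψ` (red iff …). -/
def bookNewB (s : Finset ι) (i : Fin k) : Prop :=
  (bookKeep lf ea eb W s i ∧ eb i ∈ s) ∨ (¬ bookKeep lf ea eb W s i ∧ ea i ∈ s)

open Classical in
/-- The map `ψ` on colourings of the book graph (the spine `e` stays red). -/
noncomputable def bookPsi (s : Finset ι) : Finset ι :=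
  insert e (((Finset.univ.filter fun i => bookNewA lf ea eb W s i).image ea) ∪
    ((Finset.univ.filter fun i => bookNewB lf ea eb W s i).image eb))

omit [DecidableEq ι] in
include hxh hlx hlh hlf hends_e hends_a hends_b in
/-- Distinctness of the edges of a book graph (from their end-point sets). [folklore] -/
theorem book_edges_distinct :
    (∀ i, ea i ≠ e) ∧ (∀ i, eb i ≠ e) ∧ (∀ i j, ea i ≠ eb j) ∧ Function.Injective ea ∧ Function.Injective eb := by
  refine ⟨fun i hc => ?_, fun i hc => ?_, fun i j hc => ?_, fun i j hc => ?_, fun i j hc => ?_⟩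
  · have h1 : ends (ea i) = ends e := by rw [hc]
    rw [hends_a, hends_e] at h1
    have : lf i ∈ s(x, h) := by rw [← h1]; exact Sym2.mem_mk_right x (lf i)
    rcases Sym2.mem_iff.mp this with h2 | h2
    · exact hlx i h2
    · exact hlh i h2
  · have h1 : ends (eb i) = ends e := by rw [hc]
    rw [hends_b, hends_e] at h1
    have : lf i ∈ s(x, h) := by rw [← h1]; exact Sym2.mem_mk_left (lf i) h
    rcases Sym2.mem_iff.mp this with h2 | h2
    · exact hlx i h2
    · exact hlh i h2
  · have h1 : ends (ea i) = ends (eb j) := by rw [hc]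
    rw [hends_a, hends_b] at h1
    have : x ∈ s(lf j, h) := by rw [← h1]; exact Sym2.mem_mk_left x (lf i)
    rcases Sym2.mem_iff.mp this with h2 | h2
    · exact hlx j h2.symm
    · exact hxh h2
  · have h1 : ends (ea i) = ends (ea j) := by rw [hc]
    rw [hends_a, hends_a] at h1
    have : lf i ∈ s(x, lf j) := by rw [← h1]; exact Sym2.mem_mk_right x (lf i)
    rcases Sym2.mem_iff.mp this with h2 | h2
    · exact absurd h2 (hlx i)
    · exact hlf h2
  · have h1 : ends (eb i) = ends (eb j) := by rw [hc]
    rw [hends_b, hends_b] at h1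
    have : lf i ∈ s(lf j, h) := by rw [← h1]; exact Sym2.mem_mk_left (lf i) h
    rcases Sym2.mem_iff.mp this with h2 | h2
    · exact hlf h2
    · exact absurd h2 (hlh i)

open Classical in
include hxh hlx hlh hlf hends_e hends_a hends_b in
/-- Membership of the edges in `ψ s`. [folklore] -/
theorem book_mem_psi (s : Finset ι) :
    e ∈ bookPsi lf ea eb e W s ∧
    (∀ i, ea i ∈ bookPsi lf ea eb e W s ↔ bookNewA lf ea eb W s i) ∧
    (∀ i, eb i ∈ bookPsi lf ea eb e W s ↔ bookNewB lf ea eb W s i) := by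
  obtain ⟨hae, hbe, hab, hainj, hbinj⟩ := book_edges_distinct ends x h lf ea eb e hxh hlx hlh hlf hends_e hends_a hends_b
  refine ⟨Finset.mem_insert_self _ _, fun i => ?_, fun i => ?_⟩
  · rw [bookPsi, Finset.mem_insert, Finset.mem_union, Finset.mem_image, Finset.mem_image]
    constructor
    · rintro (h1 | ⟨j, hj, hji⟩ | ⟨j, _, hji⟩)
      · exact absurd h1 (hae i)
      · rw [← hainj hji]; exact (Finset.mem_filter.mp hj).2
      · exact absurd hji.symm (hab i j)
    · intro hA
      exact Or.inr (Or.inl ⟨i, Finset.mem_filter.mpr ⟨Finset.mem_univ _, hA⟩, rfl⟩)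
  · rw [bookPsi, Finset.mem_insert, Finset.mem_union, Finset.mem_image, Finset.mem_image]
    constructor
    · rintro (h1 | ⟨j, _, hji⟩ | ⟨j, hj, hji⟩)
      · exact absurd h1 (hbe i)
      · exact absurd hji (hab j i)
      · rw [← hbinj hji]; exact (Finset.mem_filter.mp hj).2
    · intro hB
      exact Or.inr (Or.inr ⟨i, Finset.mem_filter.mpr ⟨Finset.mem_univ _, hB⟩, rfl⟩)

open Classical in
include hE in
/-- `ψ s ⊆ E`. [folklore] -/
theorem book_psi_subset (s : Finset ι) : bookPsi lf ea eb e W s ⊆ E := by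
  intro j hj
  rw [bookPsi, Finset.mem_insert, Finset.mem_union, Finset.mem_image, Finset.mem_image] at hj
  rw [hE]
  rcases hj with rfl | ⟨i, _, rfl⟩ | ⟨i, _, rfl⟩
  · exact Or.inl rfl
  · exact Or.inr (Or.inl ⟨i, rfl⟩)
  · exact Or.inr (Or.inr ⟨i, rfl⟩)

end Book

end Coefficientwise

end Summit.CriticalPhenomena.PercolationContinuityZ3.Theorems
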